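/-
COR-CM (cell pub-hodgecm2, stage 2 of the Hodge ladder) — count-neutral KERNEL COMBINATORICS «β resp. β − 2 faces for every Galois CM field with group
Q₈ × ℤ/m resp. D₄ × ℤ/m (m odd ≥ 3)» (seat prover-pub-hodgecm2-b23-g45-0, binder prover b23, gen 45; own census lane OCTIC-PRODUCT, claim HOME/INBOX.md l.18829).
Theorems only; no geometry beyond the tree's `Face` / `faceOfG`, no `Universe` field touched, no named fact, nothing asserted; the lane
`Census/OcticProduct*` (this seat), gen 44ʼs slot datum (`Census/QuarticInversionCyclic.exists_slot_datum`), the generic transfer `CorCM/FaceGenerationTransfer.lean`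
and the INT2-GEN socket (`CorCM/FacePeriodsGeneratingSet.lean`) are used BY NAME; `Interfaces.lean` (C1), every E term, B01, `Transposition/*`, `PortJoin/*`,
`D2Bridge/*` are untouched.
HONEST FRAMING (COORDINATOR RULING — HODGE FRAMING CORRECTION, 2026-08-21T11:55:35Z): `HC_CM` is NOT proved, here or anywhere in the tree;
this file produces no period and proves no face period for any field; its `HodgeConjectureFor` statements are CONDITIONAL on face periods.
T5: n/a-class — the only Prop hypothesis binders displayed are the octic product datum, `m` odd, `3 ≤ m` and INT2-GEN's period hypothesis on the
produced face set (§3); no named-fact / conjecture-def binder; checker: self (prover-pub-hodgecm2-b23-g45-0), 2026-08-24.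
-/
import Summits.HodgeConjecture.CorCM.Census.OcticProductCyclic
import Summits.HodgeConjecture.CorCM.Census.OcticProductExhaust
import Summits.HodgeConjecture.CorCM.FaceGenerationTransfer
import Summits.HodgeConjecture.CorCM.FaceCensusOddSliceTransport
import HarnessLib

/-!
# Galois CM fields with group `Q₈ × ℤ/m` resp. `D₄ × ℤ/m` (`m` odd `≥ 3`): EXACTLY `φ₂` (`= β` resp. `β − 2`) generating rank-four faces

Let `F` be a Galois CM field whose Galois translates `GalT F` carry an OCTIC PRODUCT DATUM over `ℤ/m`, `m` odd `≥ 3`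
(`Census/OcticProductDictionary.lean`, `OcticProduct.Datum (GalT F) conjT (ZMod m) ζ`): an embedded CENTRAL copy `ι : ℤ/2 × ℤ/m ↪ GalT F` with
`ι (1,0) = conjT`, translates `y`, `t` centralising it with `y² = ι (ζ, 0)`, `t² = conjT`, `y t = conjT·t·y`, the four cosets exhausting `GalT F` —
i.e. `Gal(F/ℚ) ≅ Q₈ × ℤ/m` with complex conjugation `(−1, 0)` for `ζ = 1` and `Gal(F/ℚ) ≅ D₄ × ℤ/m` with complex conjugation `(r², 0)` for `ζ = 0`:
`F = K·L` with `K` a Galois CM OCTIC field of quaternion resp. dihedral type and `L` a totally real cyclic field of odd degree `m` (`[F:ℚ] = 8m ≥ 24`).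
Complex conjugation lies in the Frattini subgroup of the octic factor: none of `CorCM/FaceAbelian*`, `CorCM/FaceComplement*`, `CorCM/FaceCyclicGeneration`,
`CorCM/FaceQuarticTwist*` (`c` in a cyclic direct factor), `CorCM/FaceDicyclicTwist*`, `CorCM/FaceQuarticInversion*` (`y` inverting `B`) covers these
groups for `m ≥ 3`.  Write `β(F) = #Block conjT`.

* §1 **`isLeast_card_faces_hgen_of_octic`** (both `ζ` at once): for every base embedding `σ₀` the least size of a finite set `𝒮` of rank-four faces of
  `F` satisfying INT2-GEN's generation binder `hgen(𝒮, σ₀)` is **EXACTLY `φ₂(F)`**, the coinvariant fibre of `(GalT F, conjT)` — in the block currency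
  (`m = 2k + 1`) **EXACTLY `β(F)`** for `Q₈ × ℤ/m` (`isLeast_card_faces_hgen_of_octic_one`) resp. **EXACTLY `β(F) − 2`** for `D₄ × ℤ/m` (`…_zero`).
  Existence is this seat's generation theorem (`Census/OcticProductGeneration.lean`: one potential-reducing face per non-residual block and gen 44ʼs ten
  closing faces `B1`) transported to `CMF (GalT F) conjT` (`Census/OcticProduct{Transport,Law,Cyclic}.lean`); the floor is seat b09's coinvariant floor
  with lit-andre-3's type-stabiliser closed form (`Census/OcticProductStabiliser.lean`: `β = φ₂` resp. `β = φ₂ + 2`); both are carried to the field by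
  `CorCM/FaceGenerationTransfer.lean` (`FaceTransfer.isLeast_card_faces_hgen_of_intrinsic`).  First rows (`Census/OcticProductBlockCount.lean`):
  group `Q₈ × ℤ/3` (degree `24`): EXACTLY `172` faces (lit-andre-3ʼs `Census/TwentyFourC3Q8*`: «172 minimal»); group `D₄ × ℤ/3` (degree `24`,
  conjugation `(r², 0)`): EXACTLY `182` (`β = 184`) — `isLeast_card_faces_hgen_oneHundredSeventyTwo/_oneHundredEightyTwo`.
* §2 the degree (`eight_mul_eq_finrank`) and the datum from the automorphism group (`exists_datum_of_aut`).
* §3 **`hodgeConjectureFor_of_octic_of_exists_facePeriod`** (INT2-GEN socket BY NAME, both `ζ`): a face set with `|𝒮| = φ₂(F)` EXISTS whose periods on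
  the universe of record give the Hodge conjecture for every abelian variety dominated by a product of CM abelian varieties with CM by subfields of
  `F` — CONDITIONAL on those periods; `HC_CM` is NOT proved.

References: [cite: Pohlmann1968, Thm. 1]; [cite: Milne1999LefschetzClasses, Thm. 3.2, Prop. 2.1]; [cite: Shimura1998, §6.2 Theorem 3 and §6.1
Corollary of Theorem 2 (pp. 41–43), §8.1 (p. 62)]; [cite: MumfordAV1970, §19 Thm. 1 and p. 169].
-/

noncomputable section

open CategoryTheory NumberField NumberField.ComplexEmbedding
open Literature.AlgebraicGeometry Literature.AlgebraicGeometry.Motives Literature.AlgebraicGeometry.HodgeTheory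
open Literature.AlgebraicGeometry.ComplexMultiplication Literature.AlgebraicGeometry.Milne1999
open Literature.NumberTheory.Automorphic
open Literature.NumberTheory.Automorphic.PicardCM
open Summit.HodgeConjecture.CorCM.Domination

namespace Summit.HodgeConjecture.CorCM.FaceOcticProduct

open Summit.HodgeConjecture.CorCM.Prior.AllgGroup.RfwfAllgGroup
open Summit.HodgeConjecture.CorCM.Census.BlockParity
open Summit.HodgeConjecture.CorCM.Census.Coinvariant
open Summit.HodgeConjecture.CorCM.Census
open Summit.HodgeConjecture.CorCM.FaceCensus.OddSlice (galTOfAut galTOfAut_mul galTOfAut_conjAut)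

/-! ## §1 Octic product datum on the Galois translates: exactly `φ₂(F)` (`= β(F)` resp. `β(F) − 2`) generating faces -/

section Field

variable {F : Type} [Field F] [NumberField F] {m : ℕ} [NeZero m]

/-- **EVERY GALOIS CM FIELD WITH GROUP `Q₈ × ℤ/m` OR `D₄ × ℤ/m` (complex conjugation `(−1,0)` resp. `(r², 0)`, `m` odd `≥ 3`) HAS `φ₂` GENERATING
FACES, AND NONE FEWER** — the coinvariant floor is attained (both square classes `ζ` at once). [folklore] -/
theorem isLeast_card_faces_hgen_of_octic [IsCMField F] [IsGalois ℚ F] {ζ : ZMod 2} (D : OcticProduct.Datum (GalT F) conjT (ZMod m) ζ)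
    (hm : Odd m) (h3 : 3 ≤ m) (σ₀ : F →+* ℂ) :
    IsLeast {n : ℕ | ∃ 𝒮 : Finset (Face F), 𝒮.card = n ∧
      ∀ f : Face F, lefChar f.corner (fun _ => ({σ₀} : Finset (F →+* ℂ))) ∈ AddSubgroup.closure
        {a : Asym F | ∃ g ∈ (𝒮 : Set (Face F)), ∃ σ : F →+* ℂ, a = lefChar g.corner (fun _ => ({σ} : Finset (F →+* ℂ)))}}
      (fibreTwo (conjT : GalT F) conjT_mul_self) := by
  refine FaceTransfer.isLeast_card_faces_hgen_of_intrinsic _ ?_ (fun S₀ hS₀ hS => ?_) σ₀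
  · obtain ⟨S, hS, hcard, hgen⟩ := (OcticProduct.isLeast_card_gfaces_generate_cyclic D conjT_mul_self hm h3).1
    exact ⟨S, hS, hcard.le, hgen⟩
  · exact fibreTwo_le_card conjT conjT_mul_self (OcticProduct.mul_c_comm D) S₀ (Submodule.span ℤ (pairSet conjT)) le_rfl hS₀
      (fun y hy => hS (gfaceSet_subset_hodgeSpan conjT conjT_mul_self hy))

/-- **Block currency, `Q₈ × ℤ/(2k+1)` (`ζ = 1`, `k ≥ 1`): EXACTLY `β(F)` generating faces.** [folklore] -/
theorem isLeast_card_faces_hgen_of_octic_one [IsCMField F] [IsGalois ℚ F] {k : ℕ} (D : OcticProduct.Datum (GalT F) conjT (ZMod (2 * k + 1)) 1)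
    (hk : 1 ≤ k) (σ₀ : F →+* ℂ) :
    IsLeast {n : ℕ | ∃ 𝒮 : Finset (Face F), 𝒮.card = n ∧
      ∀ f : Face F, lefChar f.corner (fun _ => ({σ₀} : Finset (F →+* ℂ))) ∈ AddSubgroup.closure
        {a : Asym F | ∃ g ∈ (𝒮 : Set (Face F)), ∃ σ : F →+* ℂ, a = lefChar g.corner (fun _ => ({σ} : Finset (F →+* ℂ)))}}
      (Fintype.card (Block (conjT : GalT F))) := by
  have hA : Odd (Fintype.card (ZMod (2 * k + 1))) := by rw [ZMod.card]; exact ⟨k, rfl⟩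
  rw [OcticProduct.card_block_eq_fibreTwo_of_one D (ClockTypes.not_four_dvd_addOrderOf_of_odd hA) conjT_mul_self]
  exact isLeast_card_faces_hgen_of_octic D ⟨k, rfl⟩ (by omega) σ₀

/-- **Block currency, `D₄ × ℤ/(2k+1)` with conjugation `(r², 0)` (`ζ = 0`, `k ≥ 1`): EXACTLY `β(F) − 2` generating faces.** [folklore] -/
theorem isLeast_card_faces_hgen_of_octic_zero [IsCMField F] [IsGalois ℚ F] {k : ℕ} (D : OcticProduct.Datum (GalT F) conjT (ZMod (2 * k + 1)) 0)
    (hk : 1 ≤ k) (σ₀ : F →+* ℂ) :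
    IsLeast {n : ℕ | ∃ 𝒮 : Finset (Face F), 𝒮.card = n ∧
      ∀ f : Face F, lefChar f.corner (fun _ => ({σ₀} : Finset (F →+* ℂ))) ∈ AddSubgroup.closure
        {a : Asym F | ∃ g ∈ (𝒮 : Set (Face F)), ∃ σ : F →+* ℂ, a = lefChar g.corner (fun _ => ({σ} : Finset (F →+* ℂ)))}}
      (Fintype.card (Block (conjT : GalT F)) - 2) := by
  rw [OcticProduct.card_block_eq_fibreTwo_add_two_of_zero D conjT_mul_self, Nat.add_sub_cancel]
  exact isLeast_card_faces_hgen_of_octic D ⟨k, rfl⟩ (by omega) σ₀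

/-- **Group `Q₈ × ℤ/3` (degree `24`, `ζ = 1`): EXACTLY `172` generating faces** (`β = 172`). [folklore] -/
theorem isLeast_card_faces_hgen_oneHundredSeventyTwo [IsCMField F] [IsGalois ℚ F] (D : OcticProduct.Datum (GalT F) conjT (ZMod 3) 1)
    (σ₀ : F →+* ℂ) :
    IsLeast {n : ℕ | ∃ 𝒮 : Finset (Face F), 𝒮.card = n ∧
      ∀ f : Face F, lefChar f.corner (fun _ => ({σ₀} : Finset (F →+* ℂ))) ∈ AddSubgroup.closure
        {a : Asym F | ∃ g ∈ (𝒮 : Set (Face F)), ∃ σ : F →+* ℂ, a = lefChar g.corner (fun _ => ({σ} : Finset (F →+* ℂ)))}} 172 := by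
  have h := isLeast_card_faces_hgen_of_octic_one (k := 1) D le_rfl σ₀
  rwa [OcticProduct.card_block_eq_oneHundredSeventyTwo D conjT_mul_self] at h

/-- **Group `D₄ × ℤ/3` with conjugation `(r², 0)` (degree `24`, `ζ = 0`): EXACTLY `182` generating faces** (`β = 184`). [folklore] -/
theorem isLeast_card_faces_hgen_oneHundredEightyTwo [IsCMField F] [IsGalois ℚ F] (D : OcticProduct.Datum (GalT F) conjT (ZMod 3) 0)
    (σ₀ : F →+* ℂ) :
    IsLeast {n : ℕ | ∃ 𝒮 : Finset (Face F), 𝒮.card = n ∧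
      ∀ f : Face F, lefChar f.corner (fun _ => ({σ₀} : Finset (F →+* ℂ))) ∈ AddSubgroup.closure
        {a : Asym F | ∃ g ∈ (𝒮 : Set (Face F)), ∃ σ : F →+* ℂ, a = lefChar g.corner (fun _ => ({σ} : Finset (F →+* ℂ)))}} 182 := by
  have h := isLeast_card_faces_hgen_of_octic_zero (k := 1) D le_rfl σ₀
  rwa [OcticProduct.card_block_eq_oneHundredEightyFour D conjT_mul_self] at h

/-! ## §2 The degree; the datum from the automorphism group -/

/-- **`8m` is the degree of a field with group `Q₈ × ℤ/m` resp. `D₄ × ℤ/m`.** [folklore] -/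
theorem eight_mul_eq_finrank [IsGalois ℚ F] {ζ : ZMod 2} (D : OcticProduct.Datum (GalT F) conjT (ZMod m) ζ) :
    8 * m = Module.finrank ℚ F := by
  rw [← FaceCensus.card_galT, ← OcticProduct.card_group_eq_eight_mul D, ZMod.card]

/-- Such a field has degree at least `24` when `m ≥ 3`. [folklore] -/
private theorem twentyfour_le_finrank [IsGalois ℚ F] {ζ : ZMod 2} (D : OcticProduct.Datum (GalT F) conjT (ZMod m) ζ) (h3 : 3 ≤ m) :
    24 ≤ Module.finrank ℚ F := by
  rw [← eight_mul_eq_finrank D]; omega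

/-- **The octic product datum from an `Aut`-datum.**  An injective multiplicative-to-additive `ι₀ : ℤ/2 × ℤ/m → Aut(F)` whose `ι₀ (1,0)`
induces complex conjugation at `σ₀`, automorphisms `y₀ ∉ ι₀(H₀)`, `t₀ ∉ ι₀(H₀) ∪ y₀ ι₀(H₀)` with `y₀ ι₀ a = ι₀ a y₀`, `y₀² = ι₀ (ζ,0)`,
`t₀ ι₀ a = ι₀ a t₀`, `t₀² = ι₀ (1,0)`, `y₀ t₀ = ι₀(1,0) t₀ y₀`, in a field of degree `8m`, give a datum on `GalT F` through `galTOfAut σ₀`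
(exhaustion by counting, `OcticProduct.exhaust_of_card`). [folklore] -/
theorem exists_datum_of_aut [IsGalois ℚ F] {ζ : ZMod 2} (σ₀ : F →+* ℂ) (ι₀ : ZMod 2 × ZMod m → (F ≃ₐ[ℚ] F)) (y₀ t₀ : F ≃ₐ[ℚ] F)
    (hι : ∀ a b, ι₀ (a + b) = ι₀ a * ι₀ b) (hcσ : σ₀.comp ((ι₀ (1, 0) : F ≃ₐ[ℚ] F) : F →+* F) = conjugate σ₀)
    (hy : ∀ a, y₀ * ι₀ a = ι₀ a * y₀) (hyy : y₀ * y₀ = ι₀ (ζ, 0)) (ht : ∀ a, t₀ * ι₀ a = ι₀ a * t₀) (htt : t₀ * t₀ = ι₀ (1, 0))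
    (hyt : y₀ * t₀ = ι₀ (1, 0) * t₀ * y₀) (hinj : Function.Injective ι₀) (hy_ne : ∀ a, y₀ ≠ ι₀ a) (ht_ne : ∀ a, t₀ ≠ ι₀ a)
    (hty_ne : ∀ a, t₀ ≠ y₀ * ι₀ a) (hcard : Module.finrank ℚ F = 8 * m) :
    Nonempty (OcticProduct.Datum (GalT F) conjT (ZMod m) ζ) := by
  have hinj' : Function.Injective fun a => galTOfAut σ₀ (ι₀ a) := fun a b h => hinj ((galTOfAut σ₀).injective h)
  have hmul : ∀ a b, galTOfAut σ₀ (ι₀ (a + b)) = galTOfAut σ₀ (ι₀ a) * galTOfAut σ₀ (ι₀ b) := fun a b => by rw [hι, galTOfAut_mul]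
  have hy' : ∀ a, galTOfAut σ₀ y₀ * galTOfAut σ₀ (ι₀ a) = galTOfAut σ₀ (ι₀ a) * galTOfAut σ₀ y₀ := fun a => by
    rw [← galTOfAut_mul, ← galTOfAut_mul, hy]
  have hyy' : galTOfAut σ₀ y₀ * galTOfAut σ₀ y₀ = galTOfAut σ₀ (ι₀ (ζ, 0)) := by rw [← galTOfAut_mul, hyy]
  have hyne : ∀ a, galTOfAut σ₀ y₀ ≠ galTOfAut σ₀ (ι₀ a) := fun a h => hy_ne a ((galTOfAut σ₀).injective h)
  have htne : ∀ a, galTOfAut σ₀ t₀ ≠ galTOfAut σ₀ (ι₀ a) := fun a h => ht_ne a ((galTOfAut σ₀).injective h)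
  have htyne : ∀ a, galTOfAut σ₀ t₀ ≠ galTOfAut σ₀ y₀ * galTOfAut σ₀ (ι₀ a) := fun a h => by
    rw [← galTOfAut_mul] at h; exact hty_ne a ((galTOfAut σ₀).injective h)
  exact ⟨{ ι := fun a => galTOfAut σ₀ (ι₀ a)
           y := galTOfAut σ₀ y₀
           t := galTOfAut σ₀ t₀
           map_add := hmul
           map_c := galTOfAut_conjAut σ₀ hcσ
           y_mul := hy'
           y_mul_y := hyy'
           t_mul := fun a => by
             show galTOfAut σ₀ t₀ * galTOfAut σ₀ (ι₀ a) = galTOfAut σ₀ (ι₀ a) * galTOfAut σ₀ t₀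
             rw [← galTOfAut_mul, ← galTOfAut_mul, ht]
           t_mul_t := by rw [← galTOfAut_mul, htt, galTOfAut_conjAut σ₀ hcσ]
           y_mul_t := by
             rw [← galTOfAut_conjAut σ₀ hcσ, ← galTOfAut_mul, ← galTOfAut_mul, ← galTOfAut_mul, hyt]
           inj := hinj'
           y_ne := hyne
           t_ne := htne
           t_ne' := htyne
           exhaust := OcticProduct.exhaust_of_card _ _ _ hmul hinj' hy' hyy' hyne htne htyne
             (by rw [FaceCensus.card_galT, hcard, ZMod.card]) }⟩

end Field

/-! ## §3 The Hodge-conjecture reading through the INT2-GEN socket (conditional on the face periods) -/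

variable {m : ℕ} [NeZero m]

/-- **HC for the slice of a Galois CM field with group `Q₈ × ℤ/m` or `D₄ × ℤ/m` from `φ₂` face periods** (INT2-GEN socket BY NAME; both square
classes `ζ`; CONDITIONAL on the periods — `HC_CM` is NOT proved): for `K` Galois CM with an octic product datum on `GalT K` over `ℤ/m` (`m` odd `≥ 3`)
there is a face set `𝒮` with `|𝒮| = φ₂(K)` (`= β(K)` for `ζ = 1`, `= β(K) − 2` for `ζ = 0`; none fewer can satisfy the generation binder) such that, if
every face of `𝒮` has a non-vanishing period on the universe of record, the Hodge conjecture holds for every abelian variety dominated by a product of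
CM abelian varieties with CM by subfields of `K`.
[cite: Shimura1998, §6.2 Theorem 3 and §6.1 Corollary of Theorem 2 (pp. 41–43)] [cite: Pohlmann1968, Thm. 1]
[cite: Milne1999LefschetzClasses, Thm. 3.2 and Cor. 4.5] [cite: MumfordAV1970, §19 Thm. 1 and p. 169] -/
theorem hodgeConjectureFor_of_octic_of_exists_facePeriod (K : CMField) [hGal : IsGalois ℚ K] {ζ : ZMod 2}
    (D : OcticProduct.Datum (GalT K) conjT (ZMod m) ζ) (hm : Odd m) (h3 : 3 ≤ m) (σ₀ : (K : Type) →+* ℂ) :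
    ∃ 𝒮 : Finset (Face K), 𝒮.card = fibreTwo (conjT : GalT K) conjT_mul_self ∧
      ((∀ f ∈ 𝒮, ∃ ι₁ : K →+* ℂ, f.Admissible ι₁ ∧ ∃ (V : HermSpace3 K ι₁) (σ : K →+* ℂ),
        (Model.picardCMUniverse exists_isReal_hodgeModel_holds hodgePQ_independent_of_hodgeModel_holds
          BallQuotient.ballQuotientUniformised_holds cmAbelianVarietyRealised_holds).PeriodNV ι₁ V K f.psi σ) →
      ∀ {P B : AbelianVariety ℂ}, AbelianVariety.IsProductOf (fun B : AbelianVariety ℂ =>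
        ∃ (E : Type) (_ : Field E) (_ : NumberField E) (_ : IsCMField E) (_ : E →+* (K : Type)) (Φ : CMType E)
          (ι : 𝓞 E →+* End B) (ϑ : E →+* Module.End ℂ (complexBetti B.X 1)),
          IsCMTypeRealisation Φ B ι ϑ) P →
      AVDominatedBy B P → HodgeConjectureFor B.dim B.X) := by
  obtain ⟨⟨𝒮, hcard, hgen⟩, -⟩ := isLeast_card_faces_hgen_of_octic (F := K) D hm h3 σ₀
  refine ⟨𝒮, hcard, fun h P B hP hB => ?_⟩
  have h6 : 6 ≤ Module.finrank ℚ K := le_trans (by norm_num) (twentyfour_le_finrank (F := K) D h3)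
  exact hodgeConjectureFor_of_avDominatedBy_isProductOf_of_exists_facePeriod_on K h6 (𝒮 : Set (Face K)) σ₀ hgen
    (fun f hf => h f (Finset.mem_coe.mp hf)) hP hB

end Summit.HodgeConjecture.CorCM.FaceOcticProduct

end
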